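import Literature.NumberTheory.Automorphic.GL2HeckeOperatorPrimePowerDoubleCosets
import Literature.NumberTheory.Automorphic.GL2HeckeOperatorPrimePowerRecursion
import HarnessLib

/-!
# `deg T(1, p^k) = p^{k-1}(p + 1)`: the number of cosets in the double coset `Λ diag(1, p^k) Λ`, `Λ = GL_2(ℤ)`
# (Shimura Thm. 3.24 (6))

Topic `NumberTheory/Automorphic`; namespace `Literature.NumberTheory.Automorphic.heckeAlgebra` (lane `lit-hodgefound`,
Track 2 foundations; seat `lit-hodgefound-p11`, generation 39, row g39-#12).  THEOREMS ONLY: no definition, no named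
fact, no instance, no notation.

## Source, as printed

Shimura, *Introduction to the Arithmetic Theory of Automorphic Functions* (1971), §3.3 THEOREM 3.24 (`n = 2`, `p` a
prime): «(6) `deg(T(1, p^k)) = deg(T(p^l, p^{l+k})) = p^{k-1}(p + 1)` (`k > 0`)», proved (p. 83) from «By Prop. 3.18,
we have `deg(T(p)) = c_1^{(2)} = p + 1`, and `deg(T(p, p)) = 1`», (*) `deg(T(p^k)) = 1 + p + ⋯ + p^k` and (2)
`T(1, p^k) = T(p^k) - T(p, p) T(p^{k-2})`.  Here `deg(ΓαΓ)` is the number of cosets of `Γ` in `ΓαΓ` (Prop. 3.3);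
in the tree: the number of cosets `gΛ ⊆ Λ diag(1, p^k) Λ`, i.e. the cardinality of the `Λ`-orbit of the coset
`diag(1, p^k)Λ` in `GL_2(ℚ) ⧸ Λ`.

## Proof

Exactly Shimura's: take the vectors `T [Λ] ∈ ℚ[G ⧸ Λ]` in the identity `t(p^{m+2}) = (diag(1, p^{m+2}))_Λ +
(pE_2)_Λ t(p^m)` (g39-#11, Thm. 3.24 (2)) — `𝟙_{M_2(±p^{m+2})/Λ} = 𝟙_{Λ diag(1,p^{m+2}) Λ / Λ} + ∑_{y ∈ M_2(±p^m)/Λ}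
[pE_2 · y]` — and sum coefficients: `deg T(p^{m+2}) = deg T(1, p^{m+2}) + deg T(p^m)`, with `deg T(p^k) = #(M_2(±p^k)/Λ)
= 1 + p + ⋯ + p^k` (g39-#8).

## What is formalised (theorems only)

* `card_orbit_diagonalGL_one_prime` (`k = 1`: `Λ diag(1, p) Λ / Λ = M_2(±p) / Λ` has `p + 1` elements),
  `card_orbit_diagonalGL_one_prime_pow_succ_succ` (`k = m + 2`: `p^{m+1}(p + 1)`), and
  **`card_orbit_diagonalGL_one_prime_pow`** — THM 3.24 (6): `#(Λ diag(1, p^k) Λ / Λ) = p^{k-1}(p + 1)` for `k ≥ 1`.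

## References
* [ShimuraIATAF1971] G. Shimura, *Introduction to the Arithmetic Theory of Automorphic Functions*, Publ. Math. Soc.
  Japan 11 (1971), §3.3 Thm. 3.24 (6) and its proof (p. 83); §3.1 Prop. 3.3 (`deg`).
* [AndrianovZhuravlev1995] A. N. Andrianov, V. G. Zhuravlev, *Modular Forms and Hecke Operators*, Transl. Math.
  Monogr. 145, AMS (1995), Ch. 3 §2.2 (2.10), Lemma 2.6, Problem 2.10.
-/

noncomputable section

open scoped MatrixGroups ArithmeticFunction.sigma

open MulAction MonoidAlgebra

namespace Literature.NumberTheory.Automorphic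

namespace heckeAlgebra

/-! ## §1 Summing the coefficients of a `0/1`-vector -/

/-- The sum of the coefficients of `∑_{a ∈ B} [f a]` is `#B`. [folklore] -/
private theorem sum_coeff_sum_single {k α X : Type*} [CommRing k] (B : Finset α) (f : α → X) :
    ((∑ a ∈ B, single (f a) (1 : k)).coeff.sum fun _ c => c) = B.card := by
  rw [coeff_sum, ← Finsupp.sum_finsetSum_index (fun _ => rfl) (fun _ _ _ => rfl)]
  simp only [coeff_single, Finsupp.sum_single_index]
  rw [Finset.sum_const, nsmul_eq_mul, mul_one]

/-- The sum of the coefficients of `∑_{a ∈ B} [a]` is `#B`. [folklore] -/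
private theorem sum_coeff_sum_single_self {k X : Type*} [CommRing k] (B : Finset X) :
    ((∑ a ∈ B, single a (1 : k)).coeff.sum fun _ c => c) = B.card :=
  sum_coeff_sum_single B id

/-! ## §2 THEOREM 3.24 (6) -/

section GL2

variable {p : ℕ}

/-- **`deg T(1, p) = p + 1`**: the double coset of `diag(1, p)` is all of `M_2(±p)` (`t(p) = (diag(1, p))_Λ`, the
only elementary divisor matrix of determinant `p`), which consists of `p + 1` cosets («By Prop. 3.18, we have
`deg(T(p)) = c_1^{(2)} = p + 1`»). [cite: ShimuraIATAF1971, §3.3 Thm. 3.24 (6) and proof] -/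
theorem card_orbit_diagonalGL_one_prime (hp : p.Prime) :
    (haveI := isHeckeTriple_glnInt_glnRat (Fin 2);
      (finite_orbit_quotient (Matrix.GeneralLinearGroup.map (n := Fin 2) (Int.castRingHom ℚ)).range
        (diagonalGL (Fin 2) ℚ fun i => Units.mk0 ((p : ℚ) ^ (![0, 1] : Fin 2 → ℕ) i)
          (pow_ne_zero _ (Nat.cast_ne_zero.mpr hp.ne_zero)))).toFinset.card) = p + 1 := by
  classical
  haveI := isHeckeTriple_glnInt_glnRat (Fin 2)
  -- `t(p) = (diag(1, p))_Λ`, so `𝟙_{M_2(±p)/Λ} = 𝟙_{Λ diag(1,p) Λ / Λ}` in `ℚ[G ⧸ Λ]`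
  have ht := tOperator_prime_pow_eq_sum_doubleCosetOperator ℚ hp 1
  rw [pow_one, show 1 / 2 + 1 = 1 from rfl, Finset.sum_range_one, Nat.sub_zero] at ht
  have hvec := congr_arg (fun T => ((toVector (Matrix.GeneralLinearGroup.map (n := Fin 2) (Int.castRingHom ℚ)).range
    T).coeff.sum fun _ c => c)) ht
  simp only [toVector_tOperator, toVector_doubleCosetOperator, doubleCosetIndicator_eq_sum, sum_coeff_sum_single_self,
    Nat.cast_inj] at hvec
  rw [← hvec, card_toFinset_image_mk_integral_absdet_two hp.pos, ← pow_one p,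
    ArithmeticFunction.sigma_one_apply_prime_pow hp, Finset.sum_range_succ, Finset.sum_range_one, pow_zero, pow_one,
    add_comm]

/-- **`deg T(1, p^{m+2}) = p^{m+1}(p + 1)`**: summing coefficients in `𝟙_{M_2(±p^{m+2})/Λ} = 𝟙_{Λ diag(1,p^{m+2}) Λ/Λ}
+ pE_2 · 𝟙_{M_2(±p^m)/Λ}` (Thm. 3.24 (2)) gives `(1 + ⋯ + p^{m+2}) = deg T(1, p^{m+2}) + (1 + ⋯ + p^m)`.
[cite: ShimuraIATAF1971, §3.3 Thm. 3.24 (6) and proof] -/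
theorem card_orbit_diagonalGL_one_prime_pow_succ_succ (hp : p.Prime) (m : ℕ) :
    (haveI := isHeckeTriple_glnInt_glnRat (Fin 2);
      (finite_orbit_quotient (Matrix.GeneralLinearGroup.map (n := Fin 2) (Int.castRingHom ℚ)).range
        (diagonalGL (Fin 2) ℚ fun i => Units.mk0 ((p : ℚ) ^ (![0, m + 2] : Fin 2 → ℕ) i)
          (pow_ne_zero _ (Nat.cast_ne_zero.mpr hp.ne_zero)))).toFinset.card) = p ^ (m + 1) * (p + 1) := by
  classical
  haveI := isHeckeTriple_glnInt_glnRat (Fin 2)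
  have ht := tOperator_prime_pow_succ_succ_eq ℚ hp m
  -- commute `(pE_2)_Λ` to the right, take vectors, then sum coefficients
  rw [isGelfandPair_glnInt_glnRat ℚ (Fin 2) (doubleCosetOperator _ _) (tOperator ℚ 2 (p ^ m))] at ht
  have hvec := congr_arg (toVector (Matrix.GeneralLinearGroup.map (n := Fin 2) (Int.castRingHom ℚ)).range) ht
  rw [toVector_tOperator, map_add, toVector_doubleCosetOperator, doubleCosetIndicator_eq_sum,
    toVector_mul_doubleCosetOperator_central _ (pScalar_comm hp.pos) _ (toVector_tOperator ℚ 2 (p ^ m))] at hvec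
  have hsum := congr_arg (fun v : MonoidAlgebra ℚ
      (GL (Fin 2) ℚ ⧸ (Matrix.GeneralLinearGroup.map (n := Fin 2) (Int.castRingHom ℚ)).range) =>
    v.coeff.sum fun _ c => c) hvec
  rw [coeff_add, Finsupp.sum_add_index' (h := fun _ c => c) (fun _ => rfl) (fun _ _ _ => rfl),
    sum_coeff_sum_single_self, sum_coeff_sum_single_self, sum_coeff_sum_single,
    card_toFinset_image_mk_integral_absdet_two (pow_pos hp.pos _),
    card_toFinset_image_mk_integral_absdet_two (pow_pos hp.pos _), ArithmeticFunction.sigma_one_apply_prime_pow hp,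
    ArithmeticFunction.sigma_one_apply_prime_pow hp, Finset.sum_range_succ, Finset.sum_range_succ] at hsum
  -- `hsum : 1 + ⋯ + p^m + p^{m+1} + p^{m+2} = #(Λ diag(1,p^{m+2}) Λ / Λ) + (1 + ⋯ + p^m)` in `ℚ`
  have h : (haveI := isHeckeTriple_glnInt_glnRat (Fin 2);
      (finite_orbit_quotient (Matrix.GeneralLinearGroup.map (n := Fin 2) (Int.castRingHom ℚ)).range
        (diagonalGL (Fin 2) ℚ fun i => Units.mk0 ((p : ℚ) ^ (![0, m + 2] : Fin 2 → ℕ) i)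
          (pow_ne_zero _ (Nat.cast_ne_zero.mpr hp.ne_zero)))).toFinset.card) = p ^ (m + 1) + p ^ (m + 2) := by
    have h' : ((∑ i ∈ Finset.range (m + 1), p ^ i + p ^ (m + 1) + p ^ (m + 2) : ℕ) : ℚ) =
        ((haveI := isHeckeTriple_glnInt_glnRat (Fin 2);
          (finite_orbit_quotient (Matrix.GeneralLinearGroup.map (n := Fin 2) (Int.castRingHom ℚ)).range
            (diagonalGL (Fin 2) ℚ fun i => Units.mk0 ((p : ℚ) ^ (![0, m + 2] : Fin 2 → ℕ) i)
              (pow_ne_zero _ (Nat.cast_ne_zero.mpr hp.ne_zero)))).toFinset.card) +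
          ∑ i ∈ Finset.range (m + 1), p ^ i : ℕ) := by
      push_cast at hsum ⊢
      linarith
    have h'' := (Nat.cast_injective (R := ℚ)) h'
    omega
  rw [h]
  ring

/-- **SHIMURA THEOREM 3.24 (6): `deg T(1, p^k) = p^{k-1}(p + 1)` for `k ≥ 1`** — the double coset
`Λ diag(1, p^k) Λ`, `Λ = GL_2(ℤ)`, is the union of exactly `p^{k-1}(p + 1)` cosets `gΛ`.
[cite: ShimuraIATAF1971, §3.3 Thm. 3.24 (6)] -/
theorem card_orbit_diagonalGL_one_prime_pow (hp : p.Prime) {k : ℕ} (hk : 1 ≤ k) :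
    (haveI := isHeckeTriple_glnInt_glnRat (Fin 2);
      (finite_orbit_quotient (Matrix.GeneralLinearGroup.map (n := Fin 2) (Int.castRingHom ℚ)).range
        (diagonalGL (Fin 2) ℚ fun i => Units.mk0 ((p : ℚ) ^ (![0, k] : Fin 2 → ℕ) i)
          (pow_ne_zero _ (Nat.cast_ne_zero.mpr hp.ne_zero)))).toFinset.card) = p ^ (k - 1) * (p + 1) := by
  rcases k with _ | k
  · exact absurd hk (by decide)
  · rcases k with _ | m
    · rw [card_orbit_diagonalGL_one_prime hp, show 0 + 1 - 1 = 0 from rfl, pow_zero, one_mul]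
    · rw [show m + 1 + 1 - 1 = m + 1 from rfl, show m + 1 + 1 = m + 2 from rfl,
        card_orbit_diagonalGL_one_prime_pow_succ_succ hp m]

end GL2

end heckeAlgebra

end Literature.NumberTheory.Automorphic
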